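import Summits.CriticalPhenomena.PercolationContinuityZ3.Theorems.PercShatteringRaceNearLinearTwoClusterDecayChildTwoJumpWorld
import Summits.CriticalPhenomena.PercolationContinuityZ3.Theorems.PercShatteringRaceNearLinearTwoClusterDecayPairDecayNullWorld
import HarnessLib

/-!
# Crux `PercShatteringRace.NearLinearTwoClusterDecay` (stmt-CriticalPhenomena-5785) — child 1 self-improves from its AVERAGED form

Helper file of the lead (seat c10) of the line `pair-decay-long-arms-dense`
(`Cruxes/NearLinearTwoClusterDecay/Lines/pair_decay_long_arms_dense.lean`); lands with
`--supports stmt-CriticalPhenomena-5785`.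

**Child 1 (`PairTwoArmsDecay`, the form `closes` consumes) is equivalent — unconditionally, no case
left open — to its AVERAGED form**

  `AvgPairDecay :  ∀ ε > 0, ∀ᶠ n, ∀ x ∈ Λ(n),  Σ_{w ∈ Λ(n)} P_{p_c}(pairBad m x w) ≤ ε |Λ(n)|`,
  `m = ⌈n^{7/6}⌉`,

i.e. "for every deterministic `x ∈ Λ(n)`, the expected number of `w ∈ Λ(n)` that carry an in-box arm
to `∂ⁱⁿΛ(m)` FOREIGN to `x` (while `x` carries one too) is `o(|Λ(n)|)`" — the sup over the partner
`x'` is recovered from the average over partners `w` for free (`pairDecay_iff_avgPairDecay`,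
`pairTwoArmsDecay_iff_avgPairDecay`).

Proof (by worlds; both halves are tree theorems or 20-line consequences of tree theorems):
* `θ(p_c) = 0`: the pair form holds outright (`pairDecay_of_theta_eq_zero`, p137652 — one-arm decay).
* `0 < θ(p_c)`: DETERMINISTIC CORE (`percCount_le_card_badTrace_add`): on a lattice configuration in
  `pairBad m x x'`, every percolating `w ∈ Λ(n)` carries an in-box arm (first exit of its infinite
  cluster, `exists_openConnIn_innerBoundary_of_percolatesAt`) and — in-box connection being an
  equivalence relation — is NOT joined inside `Λ(m)` to at least one of `x`, `x'`, so it is a bad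
  partner of `x` or of `x'`:  `#{w ∈ Λ(n) : w ↔ ∞} ≤ #bad partners of x + #bad partners of x'`.
  DENSITY (`eventually_measureReal_compl_percCount_ge_le`, Grimmett 1999 §7.4, every `p`):
  `#{w ∈ Λ(n) : w ↔ ∞} ≥ θ|Λ(n)|/2` w.h.p.; so on `pairBad m x x'` one of the two bad-partner counts is
  `≥ θ|Λ(n)|/4` w.h.p., and MARKOV on each count (`real_badTraceFn_ge_le`) gives
  `P(pairBad m x x') ≤ P(density fails) + (4/(θ|Λ(n)|)) (Σ_w P(pairBad m x w) + Σ_w P(pairBad m x' w))`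
  (`real_pairBad_le_density_add`), which is `≤ ε` eventually under `AvgPairDecay`.

Consequences recorded: the split glue with the weaker first hypothesis
(`nearLinearTwoClusterDecay_of_avgPairDecay_of_longArmsAreDense`).  What this does NOT do: it does
not prove child 1 — the averaged form is the same scale statement ("the `Λ(m)`-cluster of a point with
a long arm swallows all but `o(|Λ(n)|)` of the arm-carrying mass of `Λ(n)`", a pointed giant-uniqueness
at aspect `n^{1/6}`), for which no engine exists below aspect exponent `36` (pair-form frontier,
p151874/p152370).  It says that rates and the sup over pairs are not where the difficulty is.

Vocabulary (`Pc`, `outer`, `reachesOut`, `pairBad`, `trace`, `percCount`, `pairDecay_iff`,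
`measurableSet_pairBad`) from `PercShatteringRaceNearLinearTwoClusterDecaySplit{Core,}.lean`,
`…ChildTwoJumpWorld.lean` and `Literature/Probability/Percolation/InfiniteClusterDensity.lean`;
no new definitions (the bad-partner count is written out as a `Finset.filter` / a finite sum of
indicators in every statement).
-/

noncomputable section

namespace Summit.CriticalPhenomena.PercolationContinuityZ3.Theorems

namespace NearLinearTwoClusterDecaySplit

open MeasureTheory Filter Topology
open Literature.Probability.LatticeModels Literature.Probability.Percolation
open Summit.CriticalPhenomena.PercolationContinuityZ3.Theses.PercShatteringRace

/-! ## The bad partners of a point and the deterministic core -/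

/-- **Deterministic core.** Let `n ≤ m`, `ω ⊆ E(ℤ³)` a lattice configuration in `pairBad m x x'`.
Every percolating `w ∈ Λ(n)` reaches `∂ⁱⁿΛ(m)` inside `Λ(m)` (first exit of its infinite cluster) and,
since in-box connection is an equivalence relation and `x`, `x'` are not joined inside `Λ(m)`, `w` is
not joined inside `Λ(m)` to `x` or not to `x'`; hence it is a bad partner of `x` or of `x'`:
`#{w ∈ Λ(n) : w ↔ ∞} ≤ #{bad partners of x} + #{bad partners of x'}`. [folklore] -/
theorem percCount_le_card_badTrace_add {n m : ℕ} (hnm : n ≤ m) {x x' : Site 3}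
    {ω : BondConfig (Site 3)} (hω : ω ⊆ (zdGraph 3).edgeSet) (h : ω ∈ pairBad m x x')
    [DecidablePred fun w => ω ∈ pairBad m x w] [DecidablePred fun w => ω ∈ pairBad m x' w] :
    percCount (box 3 n) ω ≤ ((box 3 n).filter fun w => ω ∈ pairBad m x w).card +
      ((box 3 n).filter fun w => ω ∈ pairBad m x' w).card := by
  classical
  rw [percCount_eq]
  calc ((box 3 n).filter fun w => ω ∈ percolatesAt w).card
      ≤ (((box 3 n).filter fun w => ω ∈ pairBad m x w) ∪
          ((box 3 n).filter fun w => ω ∈ pairBad m x' w)).card := by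
        refine Finset.card_le_card fun w hw => ?_
        rw [Finset.mem_filter] at hw
        obtain ⟨y, hy, hwy⟩ :=
          exists_openConnIn_innerBoundary_of_percolatesAt (box_mono 3 hnm hw.1) hω hw.2
        have hreach : ω ∈ reachesOut m w := ⟨y, hy, hwy⟩
        rw [Finset.mem_union, Finset.mem_filter, Finset.mem_filter]
        by_cases hxw : ω ∈ openConnIn ↑(box 3 m) x w
        · refine Or.inr ⟨hw.1, ⟨h.1.2, hreach⟩, fun hx'w => h.2 ?_⟩
          exact GM.openConnIn_trans hxw (GM.openConnIn_comm.1 hx'w)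
        · exact Or.inl ⟨hw.1, ⟨h.1.1, hreach⟩, hxw⟩
    _ ≤ ((box 3 n).filter fun w => ω ∈ pairBad m x w).card +
          ((box 3 n).filter fun w => ω ∈ pairBad m x' w).card := Finset.card_union_le _ _

/-! ## Markov on the bad-partner count -/

/-- The bad-partner count of `x` (the number of `w ∈ Λ(n)` with `pairBad m x w`) as a finite sum of
indicators. [folklore] -/
theorem badTraceFn_eq_card (n m : ℕ) (x : Site 3) (ω : BondConfig (Site 3))
    [DecidablePred fun w => ω ∈ pairBad m x w] :
    ∑ w ∈ box 3 n, (pairBad m x w).indicator (1 : BondConfig (Site 3) → ℝ) ω =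
      ((box 3 n).filter fun w => ω ∈ pairBad m x w).card := by
  simp only [Finset.card_filter, Set.indicator_apply, Pi.one_apply, Nat.cast_sum, Nat.cast_ite, Nat.cast_one,
    Nat.cast_zero]

/-- The bad-partner count is nonnegative. [folklore] -/
theorem badTraceFn_nonneg (n m : ℕ) (x : Site 3) (ω : BondConfig (Site 3)) :
    0 ≤ ∑ w ∈ box 3 n, (pairBad m x w).indicator (1 : BondConfig (Site 3) → ℝ) ω :=
  Finset.sum_nonneg fun _ _ => Set.indicator_nonneg (fun _ _ => zero_le_one) ω

/-- The bad-partner count is integrable (finite sum of indicators). [folklore] -/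
theorem integrable_badTraceFn (n m : ℕ) (x : Site 3) :
    Integrable (fun ω => ∑ w ∈ box 3 n, (pairBad m x w).indicator (1 : BondConfig (Site 3) → ℝ) ω) Pc := by
  refine integrable_finsetSum _ fun w _ => ?_
  exact (integrable_const (1 : ℝ)).indicator (measurableSet_pairBad m x w)

/-- First moment of the bad-partner count: `E #{w ∈ Λ(n) : pairBad m x w} = Σ_{w ∈ Λ(n)} P(pairBad m x w)`.
[folklore] -/
theorem integral_badTraceFn (n m : ℕ) (x : Site 3) :
    ∫ ω, ∑ w ∈ box 3 n, (pairBad m x w).indicator (1 : BondConfig (Site 3) → ℝ) ω ∂Pc =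
      ∑ w ∈ box 3 n, Pc.real (pairBad m x w) := by
  rw [integral_finsetSum]
  · refine Finset.sum_congr rfl fun w _ => ?_
    exact integral_indicator_one (measurableSet_pairBad m x w)
  · intro w _
    exact (integrable_const (1 : ℝ)).indicator (measurableSet_pairBad m x w)

/-- **Markov on the bad-partner count**:
`P(#{w ∈ Λ(n) : pairBad m x w} ≥ t) ≤ t⁻¹ Σ_{w ∈ Λ(n)} P(pairBad m x w)`. [folklore] -/
theorem real_badTraceFn_ge_le (n m : ℕ) (x : Site 3) {t : ℝ} (ht : 0 < t) :
    Pc.real {ω | t ≤ ∑ w ∈ box 3 n, (pairBad m x w).indicator (1 : BondConfig (Site 3) → ℝ) ω} ≤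
      t⁻¹ * ∑ w ∈ box 3 n, Pc.real (pairBad m x w) := by
  have hmarkov := mul_meas_ge_le_integral_of_nonneg (μ := Pc)
    (Eventually.of_forall (badTraceFn_nonneg n m x)) (integrable_badTraceFn n m x) t
  rw [integral_badTraceFn] at hmarkov
  rw [← div_eq_inv_mul, le_div_iff₀ ht, mul_comm]
  exact hmarkov

/-! ## From the average over partners to every partner -/

/-- **Inclusion of events** (lattice configurations): on `pairBad m x x'`, either the percolating count
of `Λ(n)` is below `θ'|Λ(n)|/2`, or one of `x`, `x'` has at least `θ'|Λ(n)|/4` bad partners. [folklore] -/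
theorem pairBad_subset_density_union {n m : ℕ} (hnm : n ≤ m) (x x' : Site 3) (θ' : ℝ)
    {ω : BondConfig (Site 3)} (hω : ω ⊆ (zdGraph 3).edgeSet) (h : ω ∈ pairBad m x x') :
    ω ∈ {ω | θ' / 2 * ((box 3 n).card : ℝ) ≤ (percCount (box 3 n) ω : ℝ)}ᶜ ∪
      ({ω | θ' / 4 * ((box 3 n).card : ℝ) ≤
          ∑ w ∈ box 3 n, (pairBad m x w).indicator (1 : BondConfig (Site 3) → ℝ) ω} ∪
        {ω | θ' / 4 * ((box 3 n).card : ℝ) ≤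
          ∑ w ∈ box 3 n, (pairBad m x' w).indicator (1 : BondConfig (Site 3) → ℝ) ω}) := by
  classical
  by_cases hd : θ' / 2 * ((box 3 n).card : ℝ) ≤ (percCount (box 3 n) ω : ℝ)
  · refine Or.inr ?_
    have hcore : (percCount (box 3 n) ω : ℝ) ≤
        ∑ w ∈ box 3 n, (pairBad m x w).indicator (1 : BondConfig (Site 3) → ℝ) ω +
          ∑ w ∈ box 3 n, (pairBad m x' w).indicator (1 : BondConfig (Site 3) → ℝ) ω := by
      rw [badTraceFn_eq_card, badTraceFn_eq_card]
      exact_mod_cast percCount_le_card_badTrace_add hnm hω h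
    by_cases h1 : θ' / 4 * ((box 3 n).card : ℝ) ≤
        ∑ w ∈ box 3 n, (pairBad m x w).indicator (1 : BondConfig (Site 3) → ℝ) ω
    · exact Or.inl h1
    · refine Or.inr ?_
      simp only [Set.mem_setOf_eq]
      have h1' := not_le.1 h1
      linarith
  · exact Or.inl hd

/-- **The quantitative step**: for `n ≤ m`, every `θ' > 0` and every pair `x, x'`,
`P(pairBad m x x') ≤ P(#{w ∈ Λ(n) : w ↔ ∞} < θ'|Λ(n)|/2)
  + (θ'|Λ(n)|/4)⁻¹ (Σ_{w ∈ Λ(n)} P(pairBad m x w) + Σ_{w ∈ Λ(n)} P(pairBad m x' w))`. [folklore] -/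
theorem real_pairBad_le_density_add {n m : ℕ} (hnm : n ≤ m) (x x' : Site 3) {θ' : ℝ} (hθ' : 0 < θ') :
    Pc.real (pairBad m x x') ≤
      Pc.real {ω | θ' / 2 * ((box 3 n).card : ℝ) ≤ (percCount (box 3 n) ω : ℝ)}ᶜ +
        (θ' / 4 * ((box 3 n).card : ℝ))⁻¹ *
          (∑ w ∈ box 3 n, Pc.real (pairBad m x w) + ∑ w ∈ box 3 n, Pc.real (pairBad m x' w)) := by
  have hc : 0 < ((box 3 n).card : ℝ) := by exact_mod_cast Finset.card_pos.2 ⟨0, zero_mem_box 3 n⟩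
  have ht : 0 < θ' / 4 * ((box 3 n).card : ℝ) := by positivity
  calc Pc.real (pairBad m x x')
      ≤ Pc.real ({ω | θ' / 2 * ((box 3 n).card : ℝ) ≤ (percCount (box 3 n) ω : ℝ)}ᶜ ∪
          ({ω | θ' / 4 * ((box 3 n).card : ℝ) ≤
              ∑ w ∈ box 3 n, (pairBad m x w).indicator (1 : BondConfig (Site 3) → ℝ) ω} ∪
            {ω | θ' / 4 * ((box 3 n).card : ℝ) ≤
              ∑ w ∈ box 3 n, (pairBad m x' w).indicator (1 : BondConfig (Site 3) → ℝ) ω})) :=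
        DCT16.real_mono_of_forall_subset_edgeSet (zdGraph 3) (criticalProbI 3) fun ω hω hmem =>
          pairBad_subset_density_union hnm x x' θ' hω hmem
    _ ≤ Pc.real {ω | θ' / 2 * ((box 3 n).card : ℝ) ≤ (percCount (box 3 n) ω : ℝ)}ᶜ +
          (Pc.real {ω | θ' / 4 * ((box 3 n).card : ℝ) ≤
              ∑ w ∈ box 3 n, (pairBad m x w).indicator (1 : BondConfig (Site 3) → ℝ) ω} +
            Pc.real {ω | θ' / 4 * ((box 3 n).card : ℝ) ≤
              ∑ w ∈ box 3 n, (pairBad m x' w).indicator (1 : BondConfig (Site 3) → ℝ) ω}) :=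
        (measureReal_union_le _ _).trans (add_le_add le_rfl (measureReal_union_le _ _))
    _ ≤ Pc.real {ω | θ' / 2 * ((box 3 n).card : ℝ) ≤ (percCount (box 3 n) ω : ℝ)}ᶜ +
          ((θ' / 4 * ((box 3 n).card : ℝ))⁻¹ * ∑ w ∈ box 3 n, Pc.real (pairBad m x w) +
            (θ' / 4 * ((box 3 n).card : ℝ))⁻¹ * ∑ w ∈ box 3 n, Pc.real (pairBad m x' w)) :=
        add_le_add le_rfl (add_le_add (real_badTraceFn_ge_le n m x ht) (real_badTraceFn_ge_le n m x' ht))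
    _ = _ := by ring

/-- **Jump world: the averaged pair form gives the pair form.**  If `0 < θ(p_c)` and for every `ε > 0`,
eventually, for all `x ∈ Λ(n)`, `Σ_{w ∈ Λ(n)} P(pairBad ⌈n^{7/6}⌉ x w) ≤ ε|Λ(n)|`, then for every
`ε > 0`, eventually, `P(pairBad ⌈n^{7/6}⌉ x x') ≤ ε` for ALL `x, x' ∈ Λ(n)`. [folklore] -/
theorem pairDecay_of_avgPairDecay_of_theta_pos (hθ : 0 < theta (zdGraph 3) 0 (criticalProbI 3))
    (h : ∀ ε : ℝ, 0 < ε → ∀ᶠ n : ℕ in atTop, ∀ x ∈ box 3 n,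
      ∑ w ∈ box 3 n, Pc.real (pairBad (outer n) x w) ≤ ε * (box 3 n).card) :
    ∀ ε : ℝ, 0 < ε → ∀ᶠ n : ℕ in atTop, ∀ x ∈ box 3 n, ∀ x' ∈ box 3 n,
      Pc.real (pairBad (outer n) x x') ≤ ε := by
  intro ε hε
  set θ := theta (zdGraph 3) 0 (criticalProbI 3) with hθdef
  have h1 := eventually_measureReal_compl_percCount_ge_le (d := 3) (by norm_num) (criticalProbI 3)
    (half_pos hε)
  have hε' : 0 < θ * ε / 16 := by positivity
  filter_upwards [h1, h (θ * ε / 16) hε'] with n hn1 hn2 x hx x' hx'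
  have hle : n ≤ outer n := le_nat_ceil_rpow (by norm_num : (1 : ℝ) ≤ 7 / 6) n
  have hc : 0 < ((box 3 n).card : ℝ) := by exact_mod_cast Finset.card_pos.2 ⟨0, zero_mem_box 3 n⟩
  calc Pc.real (pairBad (outer n) x x')
      ≤ Pc.real {ω | θ / 2 * ((box 3 n).card : ℝ) ≤ (percCount (box 3 n) ω : ℝ)}ᶜ +
          (θ / 4 * ((box 3 n).card : ℝ))⁻¹ *
            (∑ w ∈ box 3 n, Pc.real (pairBad (outer n) x w) +
              ∑ w ∈ box 3 n, Pc.real (pairBad (outer n) x' w)) :=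
        real_pairBad_le_density_add hle x x' hθ
    _ ≤ ε / 2 + (θ / 4 * ((box 3 n).card : ℝ))⁻¹ *
          (θ * ε / 16 * (box 3 n).card + θ * ε / 16 * (box 3 n).card) :=
        add_le_add hn1 (mul_le_mul_of_nonneg_left (add_le_add (hn2 x hx) (hn2 x' hx'))
          (by positivity))
    _ = ε := by
        field_simp
        ring

/-- The pair form gives the averaged pair form (sum of `|Λ(n)|` terms each `≤ ε`). [folklore] -/
theorem avgPairDecay_of_pairDecay
    (h : ∀ ε : ℝ, 0 < ε → ∀ᶠ n : ℕ in atTop, ∀ x ∈ box 3 n, ∀ x' ∈ box 3 n,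
      Pc.real (pairBad (outer n) x x') ≤ ε) :
    ∀ ε : ℝ, 0 < ε → ∀ᶠ n : ℕ in atTop, ∀ x ∈ box 3 n,
      ∑ w ∈ box 3 n, Pc.real (pairBad (outer n) x w) ≤ ε * (box 3 n).card := by
  intro ε hε
  filter_upwards [h ε hε] with n hn x hx
  calc ∑ w ∈ box 3 n, Pc.real (pairBad (outer n) x w) ≤ ∑ w ∈ box 3 n, ε :=
        Finset.sum_le_sum fun w hw => hn x hx w hw
    _ = ε * (box 3 n).card := by rw [Finset.sum_const, nsmul_eq_mul, mul_comm]

/-- **The averaged pair form gives the pair form, unconditionally** (excluded middle on `θ(p_c) = 0`: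
the orthodox half is `pairDecay_of_theta_eq_zero`, p137652; the jump half is
`pairDecay_of_avgPairDecay_of_theta_pos`). [folklore] -/
theorem pairDecay_of_avgPairDecay
    (h : ∀ ε : ℝ, 0 < ε → ∀ᶠ n : ℕ in atTop, ∀ x ∈ box 3 n,
      ∑ w ∈ box 3 n, Pc.real (pairBad (outer n) x w) ≤ ε * (box 3 n).card) :
    ∀ ε : ℝ, 0 < ε → ∀ᶠ n : ℕ in atTop, ∀ x ∈ box 3 n, ∀ x' ∈ box 3 n,
      Pc.real (pairBad (outer n) x x') ≤ ε := by
  by_cases hθ : theta (zdGraph 3) 0 (criticalProbI 3) = 0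
  · exact pairDecay_of_theta_eq_zero hθ
  · exact pairDecay_of_avgPairDecay_of_theta_pos (lt_of_le_of_ne measureReal_nonneg (Ne.symm hθ)) h

/-- **Child 1 ⟺ its averaged form** (file-local vocabulary). [folklore] -/
theorem pairDecay_iff_avgPairDecay :
    (∀ ε : ℝ, 0 < ε → ∀ᶠ n : ℕ in atTop, ∀ x ∈ box 3 n, ∀ x' ∈ box 3 n,
      Pc.real (pairBad (outer n) x x') ≤ ε) ↔
    (∀ ε : ℝ, 0 < ε → ∀ᶠ n : ℕ in atTop, ∀ x ∈ box 3 n,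
      ∑ w ∈ box 3 n, Pc.real (pairBad (outer n) x w) ≤ ε * (box 3 n).card) :=
  ⟨avgPairDecay_of_pairDecay, pairDecay_of_avgPairDecay⟩

end NearLinearTwoClusterDecaySplit

open MeasureTheory Filter Topology
open Literature.Probability.LatticeModels Literature.Probability.Percolation
open Summit.CriticalPhenomena.PercolationContinuityZ3.Theses.PercShatteringRace
open NearLinearTwoClusterDecaySplit

/-- **`PairTwoArmsDecay` (child 1 of the split of `U(1/6)`, the form `closes` consumes) is equivalent
to its AVERAGED form**, both in the route items' wording: for every `ε > 0`, eventually in `n`, for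
every `x ∈ Λ(n)`, the SUM over `w ∈ Λ(n)` of the probabilities that `x` and `w` both reach
`∂ⁱⁿΛ(⌈n^{7/6}⌉)` inside `Λ(⌈n^{7/6}⌉)` without being joined inside it is `≤ ε|Λ(n)|`.  Unconditional
(by worlds: one-arm decay if `θ(p_c) = 0`; density of the infinite cluster + first exits + Markov if
`0 < θ(p_c)`). [folklore] -/
theorem pairTwoArmsDecay_iff_avgPairDecay :
    (∀ ε : ℝ, 0 < ε → ∀ᶠ n : ℕ in Filter.atTop, ∀ x ∈ box 3 n, ∀ x' ∈ box 3 n,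
      (bondPercolation (zdGraph 3) (criticalProbI 3)).real
        {ω | ∃ y ∈ innerBoundary (zdGraph 3) (box 3 ⌈(n : ℝ) ^ ((7 : ℝ) / 6)⌉₊),
          ∃ y' ∈ innerBoundary (zdGraph 3) (box 3 ⌈(n : ℝ) ^ ((7 : ℝ) / 6)⌉₊),
            ω ∈ openConnIn ↑(box 3 ⌈(n : ℝ) ^ ((7 : ℝ) / 6)⌉₊) x y ∧
            ω ∈ openConnIn ↑(box 3 ⌈(n : ℝ) ^ ((7 : ℝ) / 6)⌉₊) x' y' ∧
            ω ∉ openConnIn ↑(box 3 ⌈(n : ℝ) ^ ((7 : ℝ) / 6)⌉₊) x x'} ≤ ε) ↔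
    (∀ ε : ℝ, 0 < ε → ∀ᶠ n : ℕ in Filter.atTop, ∀ x ∈ box 3 n,
      ∑ w ∈ box 3 n, (bondPercolation (zdGraph 3) (criticalProbI 3)).real
        {ω | ∃ y ∈ innerBoundary (zdGraph 3) (box 3 ⌈(n : ℝ) ^ ((7 : ℝ) / 6)⌉₊),
          ∃ y' ∈ innerBoundary (zdGraph 3) (box 3 ⌈(n : ℝ) ^ ((7 : ℝ) / 6)⌉₊),
            ω ∈ openConnIn ↑(box 3 ⌈(n : ℝ) ^ ((7 : ℝ) / 6)⌉₊) x y ∧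
            ω ∈ openConnIn ↑(box 3 ⌈(n : ℝ) ^ ((7 : ℝ) / 6)⌉₊) w y' ∧
            ω ∉ openConnIn ↑(box 3 ⌈(n : ℝ) ^ ((7 : ℝ) / 6)⌉₊) x w} ≤ ε * (box 3 n).card) := by
  have h := pairDecay_iff_avgPairDecay
  simp only [pairBad_eq, outer] at h
  exact h

/-- **The split glue with the weaker first hypothesis**: the AVERAGED pair form and child 2
(`LongArmsAreDense`) give the crux `U(1/6)` (`pairDecay_of_avgPairDecay` + the landed
`nearLinearTwoClusterDecay_of_subs`, p137625). [folklore] -/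
theorem nearLinearTwoClusterDecay_of_avgPairDecay_of_longArmsAreDense
    (h₁ : ∀ ε : ℝ, 0 < ε → ∀ᶠ n : ℕ in Filter.atTop, ∀ x ∈ box 3 n,
      ∑ w ∈ box 3 n, (bondPercolation (zdGraph 3) (criticalProbI 3)).real
        {ω | ∃ y ∈ innerBoundary (zdGraph 3) (box 3 ⌈(n : ℝ) ^ ((7 : ℝ) / 6)⌉₊),
          ∃ y' ∈ innerBoundary (zdGraph 3) (box 3 ⌈(n : ℝ) ^ ((7 : ℝ) / 6)⌉₊),
            ω ∈ openConnIn ↑(box 3 ⌈(n : ℝ) ^ ((7 : ℝ) / 6)⌉₊) x y ∧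
            ω ∈ openConnIn ↑(box 3 ⌈(n : ℝ) ^ ((7 : ℝ) / 6)⌉₊) w y' ∧
            ω ∉ openConnIn ↑(box 3 ⌈(n : ℝ) ^ ((7 : ℝ) / 6)⌉₊) x w} ≤ ε * (box 3 n).card)
    (h₂ : ∀ ε : ℝ, 0 < ε → ∃ κ : ℝ, 0 < κ ∧ ∀ᶠ n : ℕ in Filter.atTop,
      (bondPercolation (zdGraph 3) (criticalProbI 3)).real
        {ω | ∃ x ∈ box 3 n,
          (∃ y ∈ innerBoundary (zdGraph 3) (box 3 ⌈(n : ℝ) ^ ((7 : ℝ) / 6)⌉₊),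
            ω ∈ openConnIn ↑(box 3 ⌈(n : ℝ) ^ ((7 : ℝ) / 6)⌉₊) x y) ∧
          (Set.ncard {z : Site 3 | z ∈ box 3 n ∧
              ω ∈ openConnIn ↑(box 3 ⌈(n : ℝ) ^ ((7 : ℝ) / 6)⌉₊) x z} : ℝ) < κ * (box 3 n).card} ≤ ε) :
    Summit.CriticalPhenomena.PercolationContinuityZ3.Theses.PercShatteringRace.NearLinearTwoClusterDecay :=
  nearLinearTwoClusterDecay_of_subs (pairTwoArmsDecay_iff_avgPairDecay.2 h₁) h₂

end Summit.CriticalPhenomena.PercolationContinuityZ3.Theorems
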